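import Literature.Analysis.FluidPDE.PineauVicolRDSSCompactness
import Literature.Analysis.FluidPDE.PineauVicolRDSSTuning
import HarnessLib

/-!
# Pineau–Vicol 2026, Theorem 1.7 — the discharge (`pineauVicol2026_rdss_liouville_holds`)

Analysis/FluidPDE proofs file (theorems only; no definitions, no named facts) discharging the
named fact `Literature.Analysis.FluidPDE.pineauVicol2026_rdss_liouville` (`PineauVicolRSS.lean`;
B. Pineau, V. Vicol, *On rotated backwards self-similar solutions of the incompressible 3D
Navier–Stokes equations*, arXiv:2607.09619 (2026), **Theorem 1.7**, p. 7 of the text): for every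
Type I constant `C₀ > 0`,
(i) there are `α₁ > 0`, `c₁ > 1` such that every classical solution on `[−1,0)` with the Type I
bound `‖u(t,x)‖ ≤ C₀/(‖x‖ + √(−t))` which is backwards rotated DISCRETELY self-similar (1.13) with
speed `|α| ≤ α₁`, factor `c ∈ (1, c₁)` and a `C²` profile of period `2 log c` has vanishing
profile on `ℝ³ × [0, 2 log c]`;
(ii) there are `α₂ > 0`, `c₂ > 1` such that the same holds for `|α| ≥ α₂` and
`1 < c < c₂^{1/(1+α²)}`.

**Method (not the printed one).** The printed proof (§7, pp. 23–27; §8, pp. 27–29) is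
quantitative and rests on the principal-eigenpair theory of §5 and the weighted machinery of §6.
Here both parts follow, as pure EXISTENCE statements, from the indirect compactness argument of
Chae–Wolf 2017, §3 — the route the source itself records for the case `α = 0` of (i)
(Theorem 1.6 = Chae–Wolf Thm. 1.3, p. 6: "by a compactness argument"). Suppose (i) fails for
`α₁ = c₁ − 1 = 1/(n+1)`, or (ii) fails for `α₂ = n + 1`, `c₂ = 2`: this produces non-trivial
Type I RDSS classical solutions `w_n = pvAnsatz α_n U_n` with factors `c_n ↓ 1` and, in BOTH
regimes, `α_n log c_n → 0` (in (i) because `α_n → 0`; in (ii) because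
`log c_n < log 2/(1+α_n²) ≤ log 2/|α_n|` — this is what the exponent `1/(1+α²)` is for). The
fields extend backwards to `t < 0` with the same constant (footnote 21,
`exists_isClassicalNSSolutionOn_Iio_of_isRotatedDSS`; Remark 1.2 / Lemma 7.1,
`norm_profile_le_of_typeI_periodic`). For every `μ ≥ 1` one TUNES exponents `k_n` (and integers
`m_n`) so that `c_n^{k_n} → μ` while the rotation angles `2α_n log c_n^{k_n}` tend to `0` modulo
`2π` (`tendsto_pow_natFloor_log` with `m_n = 0` in regime (i); `exists_tuned_exponents` in regime
(ii), where `|α_n| → ∞`). The compactness step along tuned exponents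
(`exists_limit_rdss_tuned`, `PineauVicolRDSSCompactness.lean`, with the prescribed angle function
`Θ ≡ 0`) yields a continuous Type I bounded weak solution on `(−∞, −1/4]` which is `μ`-self-similar
WITHOUT rotation for every `μ ≥ 1` and non-trivial at `t = −1`; Chae–Wolf's conclusion
(`ChaeWolf.limit_eq_zero`: KNSS regularity + Tsai's theorem) says such a limit vanishes at
`t = −1` — contradiction.

* `false_of_rdss_sequence` — the common core: no sequence of non-trivial Type I RDSS classical
  solutions with `c_n → 1` admits, for every `μ ≥ 1`, tuned exponents with factors `→ μ` and
  angles `→ 0 (mod 2π)`.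
* `exists_tuned_exponents_of_tendsto_zero` — the (trivial) tuning in regime (i), `α_n → 0`.
* `rdss_liouville_large` — Theorem 1.7 (ii).
* `pineauVicol2026_rdss_liouville_holds` — the discharge (part (i) proved in place: its
  statement coincides with the summit-side `rdssCompact_pineauVicol_thm17_small`, not importable
  here).

History: this discharge was first written by the c2 lead of crux stmt-NavierStokesRegularity-1217
(proposals p110672 / p112029, 2026-08-16, bounced only because the gate restarted while they were
in flight) on top of its two accepted ingredient files `PineauVicolRDSSCompactness.lean` (p110588)
and `PineauVicolRDSSTuning.lean` (p110160); the file itself was lost with that seat's folder and is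
re-derived here from the ingredients.

## References

* B. Pineau, V. Vicol, arXiv:2607.09619 (2026): §1.4 (1.13)–(1.14), **Theorem 1.7** (p. 7),
  Theorem 1.6 and p. 6 (compactness), Remark 1.2, Remark 1.5, Lemma 7.1, footnote 21.
  [PineauVicol2026]
* D. Chae, J. Wolf, *Removing discretely self-similar singularities for the 3D Navier–Stokes
  equations*, Comm. PDE 42 (2017) 1359–1374 = arXiv:1610.09464, Thm. 1.3 and §3.
  [ChaeWolf2017RemovingDSS]
-/

noncomputable section

open Set Filter Function Metric
open _root_.Topology

namespace Literature.Analysis.FluidPDE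

namespace PineauVicol2026

/-! ### Bookkeeping: the class of Theorem 1.7 feeds the compactness step -/

/-- Remark 1.2 on all of `t < 0`: if the (possibly `s`-dependent) profile obeys
`‖U(y,s)‖ ≤ C₀/(1+‖y‖)` for ALL `y, s`, then the ansatz field (1.13a) obeys the Type I bound with
constant `C₀` at every `t < 0`. [cite: PineauVicol2026, Remark 1.2 (pp. 3–4) and Lemma 7.1 (p. 24)] -/
private theorem rdssHolds_hasTypeIDecay_of_profile {C₀ α : ℝ}
    {U : EuclideanSpace ℝ (Fin 3) → ℝ → EuclideanSpace ℝ (Fin 3)}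
    (hU : ∀ (y : EuclideanSpace ℝ (Fin 3)) (s : ℝ), ‖U y s‖ ≤ C₀ / (1 + ‖y‖)) :
    HasTypeIDecay C₀ (pvAnsatz α U) := by
  -- adapted from Summits/.../Theorems/TypeICertificateLadderTargetRdssLiouvilleNear.lean (c2 lead)
  intro t ht x
  have hr : 0 < Real.sqrt (-t) := Real.sqrt_pos.2 (by linarith)
  rw [norm_pvAnsatz]
  have hy := hU (rotZ (-(α * -Real.log (-t))) ((Real.sqrt (-t))⁻¹ • x)) (-Real.log (-t))
  rw [norm_rotZ, norm_smul, norm_inv, Real.norm_of_nonneg hr.le] at hy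
  calc (Real.sqrt (-t))⁻¹ *
        ‖U (rotZ (-(α * -Real.log (-t))) ((Real.sqrt (-t))⁻¹ • x)) (-Real.log (-t))‖
      ≤ (Real.sqrt (-t))⁻¹ * (C₀ / (1 + (Real.sqrt (-t))⁻¹ * ‖x‖)) :=
        mul_le_mul_of_nonneg_left hy (inv_nonneg.2 hr.le)
    _ = C₀ / (‖x‖ + Real.sqrt (-t)) := by
        field_simp
        ring

/-- A profile value which does not vanish makes the ansatz field non-zero somewhere at a negative
time: `U(y, s) ≠ 0` gives `u(−e^{−s}, √(e^{−s}) R(αs) y) ≠ 0` (the size identity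
`√(−t)|u(x,t)| = |U(y,s)|`). [cite: PineauVicol2026, proof of Lemma 7.1 (p. 24)] -/
private theorem rdssHolds_field_ne_zero_of_profile {α : ℝ}
    {U : EuclideanSpace ℝ (Fin 3) → ℝ → EuclideanSpace ℝ (Fin 3)}
    {y : EuclideanSpace ℝ (Fin 3)} {s : ℝ} (h : U y s ≠ 0) :
    ∃ t < 0, ∃ x : EuclideanSpace ℝ (Fin 3), pvAnsatz α U t x ≠ 0 := by
  -- adapted from Summits/.../Theorems/TypeICertificateLadderTargetRdssLiouvilleNear.lean (c2 lead)
  set t : ℝ := -Real.exp (-s) with ht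
  have ht0 : t < 0 := by have := Real.exp_pos (-s); linarith
  have hlog : -Real.log (-t) = s := by rw [ht, neg_neg, Real.log_exp, neg_neg]
  have hr : 0 < Real.sqrt (-t) := Real.sqrt_pos.2 (by linarith)
  refine ⟨t, ht0, Real.sqrt (-t) • rotZ (α * s) y, fun hzero => h ?_⟩
  have hn := congrArg (fun v : EuclideanSpace ℝ (Fin 3) => ‖v‖) hzero
  simp only [norm_zero] at hn
  rw [norm_pvAnsatz, hlog, inv_smul_smul₀ hr.ne', ← rotZ_add, neg_add_cancel, rotZ_zero,
    mul_eq_zero] at hn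
  rcases hn with hn | hn
  · exact absurd hn (inv_ne_zero hr.ne')
  · exact norm_eq_zero.1 hn

/-! ### The common core: no tunable sequence of non-trivial Type I RDSS solutions -/

/-- **Chae–Wolf's contradiction for rotated DSS solutions with tuned exponents.** There is no
sequence of classical Navier–Stokes solutions `(u_n, p_n)` on `[−1,0)` with a common Type I bound
(constant `C₀`), each `(α_n, c_n)`-RDSS (Pineau–Vicol (1.13)) with a `2 log c_n`-periodic profile
`U_n` NOT identically zero, with `c_n > 1`, `c_n → 1`, such that for every `μ ≥ 1` there are
exponents `k_n` and integers `m_n` with `c_n^{k_n} → μ` and `2α_n log(c_n^{k_n}) − 2πm_n → 0`: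
the fields extend to `t < 0` with the same constant, the compactness step along the tuned
exponents (`exists_limit_rdss_tuned` with `Θ ≡ 0`) gives a non-trivial Type I bounded weak limit
which is `μ`-self-similar for every `μ ≥ 1`, and `ChaeWolf.limit_eq_zero` kills it. [cite: ChaeWolf2017RemovingDSS, §3 (arXiv:1610.09464 pp. 8–9); PineauVicol2026, Theorem 1.7 and p. 6] -/
theorem false_of_rdss_sequence {C₀ : ℝ} (hC₀ : 0 < C₀) {α c : ℕ → ℝ}
    {u : ℕ → ℝ → EuclideanSpace ℝ (Fin 3) → EuclideanSpace ℝ (Fin 3)}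
    {p : ℕ → ℝ → EuclideanSpace ℝ (Fin 3) → ℝ}
    {U : ℕ → EuclideanSpace ℝ (Fin 3) → ℝ → EuclideanSpace ℝ (Fin 3)}
    (hc : ∀ n, 1 < c n) (hclim : Tendsto c atTop (𝓝 1))
    (hsol : ∀ n, IsClassicalNSSolutionOn (Ico (-1) 0) 1 0 (u n) (p n))
    (hI : ∀ n, ∀ t ∈ Ico (-1 : ℝ) 0, ∀ x : EuclideanSpace ℝ (Fin 3),
      ‖u n t x‖ ≤ C₀ / (‖x‖ + Real.sqrt (-t)))
    (hper : ∀ (n : ℕ) (y : EuclideanSpace ℝ (Fin 3)) (s : ℝ),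
      U n y (s + 2 * Real.log (c n)) = U n y s)
    (hans : ∀ n, ∀ t ∈ Ico (-1 : ℝ) 0, ∀ x : EuclideanSpace ℝ (Fin 3),
      u n t x = pvAnsatz (α n) (U n) t x)
    (hne : ∀ n, ∃ (y : EuclideanSpace ℝ (Fin 3)) (s : ℝ), U n y s ≠ 0)
    (htune : ∀ μ : ℝ, 1 ≤ μ → ∃ (k : ℕ → ℕ) (m : ℕ → ℤ),
      Tendsto (fun n => c n ^ k n) atTop (𝓝 μ) ∧
      Tendsto (fun n => α n * (2 * Real.log (c n ^ k n)) - 2 * Real.pi * m n) atTop (𝓝 0)) :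
    False := by
  have hc0 : ∀ n, 0 < c n := fun n => zero_lt_one.trans (hc n)
  -- backward extensions with some pressure (footnote 21)
  have hext : ∀ n, ∃ P : ℝ → EuclideanSpace ℝ (Fin 3) → ℝ,
      IsClassicalNSSolutionOn (Iio 0) 1 0 (pvAnsatz (α n) (U n)) P := fun n =>
    exists_isClassicalNSSolutionOn_Iio_of_isRotatedDSS (hsol n) (hc n)
      (isRotatedDSS_pvAnsatz (α := α n) (hc0 n) (hper n)) (hans n)
  choose P hP using hext
  -- the same Type I constant on all of `t < 0` (Remark 1.2 / Lemma 7.1)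
  have hIw : ∀ n, HasTypeIDecay C₀ (pvAnsatz (α n) (U n)) := fun n =>
    rdssHolds_hasTypeIDecay_of_profile
      (norm_profile_le_of_typeI_periodic (hc n) (hI n) (hper n) (hans n))
  -- non-triviality at a negative time
  have hnt : ∀ n, ∃ t < 0, ∃ x : EuclideanSpace ℝ (Fin 3), pvAnsatz (α n) (U n) t x ≠ 0 := by
    intro n
    obtain ⟨y, s, h⟩ := hne n
    exact rdssHolds_field_ne_zero_of_profile h
  -- compactness along the tuned exponents, prescribed angles `Θ ≡ 0`
  obtain ⟨v, hvc, hvI, hweak, hss, x, hx⟩ :=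
    exists_limit_rdss_tuned (Θ := fun _ => (0 : ℝ)) hC₀ hc hclim hper hP hIw hnt
      (fun μ hμ => htune μ hμ)
  -- the limit is `μ`-self-similar WITHOUT rotation for every `μ ≥ 1`
  have hss' : ∀ μ : ℝ, 1 ≤ μ → ∀ t ≤ -(1 / 4 : ℝ), ∀ x,
      v t x = μ • v (μ ^ 2 * t) (μ • x) := by
    intro μ hμ t ht y
    have h := hss μ hμ t ht y
    simpa only [neg_zero, rotZ_zero] using h
  -- Chae–Wolf's conclusion: such a limit vanishes at `t = -1`
  have h0 := ChaeWolf.limit_eq_zero hvc hvI hweak hss'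
  exact hx (by rw [h0]; rfl)

/-! ### Theorem 1.7 (i): small speeds — the tuning -/

/-- **The tuning in regime (i).** If `c_n > 1`, `c_n → 1` and the speeds tend to `0`, then for
every `μ ≥ 1` the plain exponents `k_n = ⌊log μ / log c_n⌋` (and `m_n = 0`) have factors
`c_n^{k_n} → μ` and angles `2α_n log(c_n^{k_n}) → 0`. [cite: ChaeWolf2017RemovingDSS, §3 Step 2; PineauVicol2026, Theorem 1.7 (i)] -/
theorem exists_tuned_exponents_of_tendsto_zero {c α : ℕ → ℝ} (hc : ∀ n, 1 < c n)
    (hlim : Tendsto c atTop (𝓝 1)) (hα : Tendsto α atTop (𝓝 0)) {μ : ℝ} (hμ : 1 ≤ μ) :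
    ∃ (k : ℕ → ℕ) (m : ℕ → ℤ), Tendsto (fun n => c n ^ k n) atTop (𝓝 μ) ∧
      Tendsto (fun n => α n * (2 * Real.log (c n ^ k n)) - 2 * Real.pi * m n) atTop (𝓝 0) := by
  refine ⟨fun n => ⌊Real.log μ / Real.log (c n)⌋₊, fun _ => 0, tendsto_pow_natFloor_log hc hlim hμ,
    ?_⟩
  have hk := tendsto_pow_natFloor_log hc hlim hμ
  have hμ0 : 0 < μ := one_pos.trans_le hμ
  have hlogk : Tendsto (fun n => Real.log (c n ^ ⌊Real.log μ / Real.log (c n)⌋₊)) atTop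
      (𝓝 (Real.log μ)) :=
    ((Real.continuousAt_log hμ0.ne').tendsto).comp hk
  have h := hα.mul (hlogk.const_mul 2)
  rw [zero_mul] at h
  refine h.congr fun n => ?_
  push_cast
  ring

/-! ### Theorem 1.7 (ii): large speeds, factors below `c₂^{1/(1+α²)}` -/

/-- **Pineau–Vicol 2026, Theorem 1.7 (ii), by compactness.** For every `C₀ > 0` there are
`α₂ > 0` and `c₂ > 1` such that a classical solution on `[−1,0)` with the Type I bound (constant
`C₀`) which is `(α, c)`-RDSS with `|α| ≥ α₂`, `1 < c < c₂^{1/(1+α²)}` and a `C²` profile of period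
`2 log c` has vanishing profile on `ℝ³ × [0, 2 log c]`. (Counterexamples for `α₂ = n + 1`,
`c₂ = 2` have `|α_n| → ∞` and `0 < log c_n < log 2/(1+α_n²)`, so `c_n → 1` and
`α_n log c_n → 0`; the exponents are tuned by `exists_tuned_exponents` so that the factors tend to
`μ` and the angles to `0` modulo `2π`; `false_of_rdss_sequence`.) [cite: PineauVicol2026, Theorem 1.7 (ii) (arXiv:2607.09619 p. 7)] -/
theorem rdss_liouville_large (C₀ : ℝ) (hC₀ : 0 < C₀) :
    ∃ α₂ c₂ : ℝ, 0 < α₂ ∧ 1 < c₂ ∧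
      ∀ (α c : ℝ) (u : ℝ → EuclideanSpace ℝ (Fin 3) → EuclideanSpace ℝ (Fin 3))
        (p : ℝ → EuclideanSpace ℝ (Fin 3) → ℝ)
        (U : EuclideanSpace ℝ (Fin 3) → ℝ → EuclideanSpace ℝ (Fin 3)),
        α₂ ≤ |α| → 1 < c → c < c₂ ^ (1 / (1 + α ^ 2)) →
        IsClassicalNSSolutionOn (Ico (-1) 0) 1 0 u p →
        (∀ t ∈ Ico (-1 : ℝ) 0, ∀ x : EuclideanSpace ℝ (Fin 3),
          ‖u t x‖ ≤ C₀ / (‖x‖ + Real.sqrt (-t))) →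
        ContDiff ℝ 2 (fun q : EuclideanSpace ℝ (Fin 3) × ℝ => U q.1 q.2) →
        (∀ (y : EuclideanSpace ℝ (Fin 3)) (s : ℝ), U y (s + 2 * Real.log c) = U y s) →
        (∀ t ∈ Ico (-1 : ℝ) 0, ∀ x : EuclideanSpace ℝ (Fin 3), u t x = pvAnsatz α U t x) →
        ∀ (y : EuclideanSpace ℝ (Fin 3)), ∀ s ∈ Icc (0 : ℝ) (2 * Real.log c), U y s = 0 := by
  by_contra H
  push Not at H
  -- counterexamples with `n + 1 ≤ |α_n|` and `1 < c_n < 2 ^ (1/(1+α_n²))`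
  have hpos : ∀ n : ℕ, (0 : ℝ) < (n : ℝ) + 1 := fun n => by positivity
  choose α c u p U hαd hc1 hc2 hsol hI _hU2 hper hans y s _hs hne using
    fun n : ℕ => H ((n : ℝ) + 1) 2 (hpos n) one_lt_two
  have hlog0 : ∀ n, 0 < Real.log (c n) := fun n => Real.log_pos (hc1 n)
  have hden : ∀ n, 0 < 1 + α n ^ 2 := fun n => by positivity
  -- `log c_n < log 2 / (1 + α_n²)`
  have hlogc : ∀ n, Real.log (c n) < Real.log 2 / (1 + α n ^ 2) := fun n => by
    have h := Real.log_lt_log (zero_lt_one.trans (hc1 n)) (hc2 n)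
    rwa [Real.log_rpow two_pos, one_div, inv_mul_eq_div] at h
  -- `|α_n| → ∞`
  have hα : Tendsto (fun n => |α n|) atTop atTop := by
    refine tendsto_atTop_mono (fun n => hαd n) ?_
    exact tendsto_atTop_add_const_right _ 1 tendsto_natCast_atTop_atTop
  -- `α_n log c_n → 0`: `|α_n| log c_n ≤ log 2 / |α_n|`
  have hαc : Tendsto (fun n => α n * Real.log (c n)) atTop (𝓝 0) := by
    have hb : ∀ n, |α n * Real.log (c n)| ≤ Real.log 2 / |α n| := fun n => by
      have hαn : 0 < |α n| := (hpos n).trans_le (hαd n)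
      rw [abs_mul, abs_of_pos (hlog0 n), le_div_iff₀ hαn]
      have h1 : |α n| * Real.log (c n) * |α n| ≤ Real.log (c n) * (1 + α n ^ 2) := by
        have : |α n| * |α n| = α n ^ 2 := by rw [← sq, sq_abs]
        nlinarith [hlog0 n, this]
      have h2 : Real.log (c n) * (1 + α n ^ 2) < Real.log 2 := by
        have := hlogc n
        rwa [lt_div_iff₀ (hden n)] at this
      linarith
    have hlim : Tendsto (fun n => Real.log 2 / |α n|) atTop (𝓝 0) :=
      tendsto_const_nhds.div_atTop hα
    exact squeeze_zero_norm (fun n => by rw [Real.norm_eq_abs]; exact hb n) hlim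
  -- `c_n → 1`: `|log c_n| ≤ |α_n log c_n|` since `|α_n| ≥ 1`
  have hlogclim : Tendsto (fun n => Real.log (c n)) atTop (𝓝 0) := by
    have hb : ∀ n, |Real.log (c n)| ≤ |α n * Real.log (c n)| := fun n => by
      have hαn : 1 ≤ |α n| := le_trans (by
        have := (Nat.cast_nonneg (α := ℝ) n); linarith) (hαd n)
      rw [abs_mul]
      exact le_mul_of_one_le_left (abs_nonneg _) hαn
    have h0 := hαc.abs
    rw [abs_zero] at h0
    exact squeeze_zero_norm (fun n => by rw [Real.norm_eq_abs]; exact hb n) h0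
  have hclim : Tendsto c atTop (𝓝 1) := by
    have hexp := (Real.continuous_exp.tendsto _).comp hlogclim
    rw [Real.exp_zero] at hexp
    refine hexp.congr fun n => ?_
    rw [Function.comp_apply, Real.exp_log (zero_lt_one.trans (hc1 n))]
  refine false_of_rdss_sequence hC₀ hc1 hclim hsol hI hper hans (fun n => ⟨y n, s n, hne n⟩)
    fun μ hμ => exists_tuned_exponents hc1 hclim hα hαc hμ

end PineauVicol2026

/-! ### The discharge -/

/-- **Discharge** of the named fact `pineauVicol2026_rdss_liouville` (Pineau–Vicol 2026,
Theorem 1.7, both parts), by Chae–Wolf compactness along tuned exponents. Part (ii) is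
`PineauVicol2026.rdss_liouville_large`. Part (i) is proved in place (its statement coincides
with the summit-side theorem `rdssCompact_pineauVicol_thm17_small` of the c2 lead, which a
Literature file cannot import): counterexamples for `α₁ = c₁ − 1 = 1/(n+1)` have `c_n → 1` and
`α_n → 0`, so the plain exponents tune the angles to `0`
(`PineauVicol2026.exists_tuned_exponents_of_tendsto_zero`) and
`PineauVicol2026.false_of_rdss_sequence` applies. [cite: PineauVicol2026, Theorem 1.7 (arXiv:2607.09619 p. 7); ChaeWolf2017RemovingDSS, Thm. 1.3 and §3] -/
theorem pineauVicol2026_rdss_liouville_holds : pineauVicol2026_rdss_liouville := by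
  intro C₀ hC₀
  refine ⟨?_, PineauVicol2026.rdss_liouville_large C₀ hC₀⟩
  by_contra H
  push Not at H
  -- counterexamples with `|α_n| ≤ 1/(n+1)` and `1 < c_n < 1 + 1/(n+1)`
  have hpos : ∀ n : ℕ, (0 : ℝ) < 1 / ((n : ℝ) + 1) := fun n => by positivity
  choose α c u p U hαd hc1 hc2 hsol hI _hU2 hper hans y s _hs hne using
    fun n : ℕ => H (1 / ((n : ℝ) + 1)) (1 + 1 / ((n : ℝ) + 1)) (hpos n) (by linarith [hpos n])
  -- `c n → 1`, `α n → 0`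
  have hclim : Tendsto c atTop (𝓝 1) := by
    have h0 : Tendsto (fun n : ℕ => (1 : ℝ) + 1 / ((n : ℝ) + 1)) atTop (𝓝 (1 + 0)) :=
      tendsto_const_nhds.add tendsto_one_div_add_atTop_nhds_zero_nat
    rw [add_zero] at h0
    exact tendsto_of_tendsto_of_tendsto_of_le_of_le tendsto_const_nhds h0
      (fun n => (hc1 n).le) (fun n => (hc2 n).le)
  have hαlim : Tendsto α atTop (𝓝 0) := by
    refine squeeze_zero_norm (fun n => ?_) tendsto_one_div_add_atTop_nhds_zero_nat
    rw [Real.norm_eq_abs]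
    exact hαd n
  exact PineauVicol2026.false_of_rdss_sequence hC₀ hc1 hclim hsol hI hper hans
    (fun n => ⟨y n, s n, hne n⟩)
    fun μ hμ => PineauVicol2026.exists_tuned_exponents_of_tendsto_zero hc1 hclim hαlim hμ

end Literature.Analysis.FluidPDE

end
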